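import Literature.Computability.MetaComplexity.BoundedArithQueriesIter
import HarnessLib

/-!
# Query-presentable functions in models of `T₂ⁱ`, part 3: bounded least-witness search

Trunk: CplxMeta (G14), topic `Literature/Computability/MetaComplexity` (continuation of
`BoundedArithQueries.lean`, `BoundedArithQueriesIter.lean`).  In a model
`M ⊨ BASIC + Σᵇ₁-IND + Σᵇₖ₊₁-IND` we prove Buss 1990, Thm. 12 semantically: for a
`Σᵇₖ₊₁`-definable predicate `θ(x̄, y)` and a term function `t`, the least-witness function

* `muFn θ t x̄ = (μ y ≤ t x̄) θ(x̄, y)` (and `t x̄ + 1` if there is no witness)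

is query-presentable at level `k + 1` (`IsQFn.muFn`).  Buss's proof is a binary search with
`Σᵇ` queries "`∃ y ≤ t (y < mid ∧ θ(y))`"; in the mirror-image binary format of these files the
presentation asks `|t x̄| + 1` adaptive queries: first "is there a witness at all", then, from the
most significant bit down, "is there a witness whose bits above position `p` are the bits of the
least witness already determined and whose bit `p` is `0`" — the answer bits are the complemented
bits of the least witness, which the output function recovers (`QPres.mu`, `QPres.eval_mu`).
The correctness proof is an open induction on the number of determined bits, the answer code and
the least witness (which exists by `Σᵇₖ₊₁-MIN`) being parameters.

## References

* S. R. Buss, *Axiomatizations and conservation results for fragments of bounded arithmetic*,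
  Contemp. Math. 106, AMS 1990: §3, Thm. 12.
-/

namespace Literature.Computability.MetaComplexity

namespace BASICModel

open FirstOrder FirstOrder.Language

variable {M : Type} [Language.boundedArith.Structure M] [hB : M ⊨ BASIC]
  [hI : M ⊨ INDScheme (sigmabFormulas 1)]

section Mu

variable {k n : ℕ}

/-! ## The least-witness function -/

open scoped Classical in
/-- **`muFn θ t x̄`**: the least `y ≤ t x̄` with `θ(x̄, y)`, and `t x̄ + 1` if there is none (or no
least one) (Buss 1990, Thm. 12: `(μx ≤ z) A(x, v⃗)`). [cite: BussContempMath1990, Thm. 12] -/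
noncomputable def muFn (θ : (Fin (n + 1) → M) → Prop) (t : (Fin n → M) → M) (x : Fin n → M) : M :=
  if h : ∃ y, (y ≤ t x ∧ θ (Fin.snoc x y)) ∧ ∀ y', y' < y → ¬(y' ≤ t x ∧ θ (Fin.snoc x y'))
  then Classical.choose h else t x + 1

variable {θ : (Fin (n + 1) → M) → Prop} {t : (Fin n → M) → M}

omit hI in
/-- The witness predicate `y ≤ t x̄ ∧ θ(x̄, y)` at fixed `x̄` is `Σᵇₖ₊₁`-definable in `y`. [folklore] -/
theorem isSigmabDef_witness (hθ : IsSigmabDef (k + 1) θ) (x : Fin n → M) :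
    IsSigmabDef (k + 1) fun v : Fin 1 → M => v 0 ≤ t x ∧ θ (Fin.snoc x (v 0)) := by
  refine (((isQFDef_le (IsTermFn.proj 0) (IsTermFn.const (t x))).isSigmabDef _).and
    (hθ.substAll (isTermFn_snoc_apply x))).of_iff fun v => ?_
  simp

omit hI in
/-- **A witness below `t x̄` gives a least witness** (`Σᵇₖ₊₁-MIN` in a model of `Σᵇₖ₊₁-IND`).
[cite: Buss1986, §2.3] -/
theorem exists_least_witness (hIk : M ⊨ INDScheme (sigmabFormulas (k + 1)))
    (hθ : IsSigmabDef (k + 1) θ) (x : Fin n → M) {y : M} (hy : y ≤ t x ∧ θ (Fin.snoc x y)) :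
    ∃ y₀, (y₀ ≤ t x ∧ θ (Fin.snoc x y₀)) ∧ ∀ y', y' < y₀ → ¬(y' ≤ t x ∧ θ (Fin.snoc x y')) :=
  exists_least_level hIk (P := fun y => y ≤ t x ∧ θ (Fin.snoc x y)) (isSigmabDef_witness hθ x) hy

omit hI in
/-- The specification of `muFn`: either it is the least witness, or there is no witness and it is
`t x̄ + 1`. [cite: BussContempMath1990, Thm. 12] -/
theorem muFn_spec (hIk : M ⊨ INDScheme (sigmabFormulas (k + 1))) (hθ : IsSigmabDef (k + 1) θ)
    (x : Fin n → M) :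
    ((muFn θ t x ≤ t x ∧ θ (Fin.snoc x (muFn θ t x))) ∧
        ∀ y', y' < muFn θ t x → ¬(y' ≤ t x ∧ θ (Fin.snoc x y'))) ∨
      ((∀ y, ¬(y ≤ t x ∧ θ (Fin.snoc x y))) ∧ muFn θ t x = t x + 1) := by
  unfold muFn
  split_ifs with h
  · exact Or.inl (Classical.choose_spec h)
  · exact Or.inr ⟨fun y hy => h (exists_least_witness hIk hθ x hy), rfl⟩

omit hI in
/-- `muFn ≤ t x̄ + 1`. [folklore] -/
theorem muFn_le (hIk : M ⊨ INDScheme (sigmabFormulas (k + 1))) (hθ : IsSigmabDef (k + 1) θ)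
    (x : Fin n → M) : muFn θ t x ≤ t x + 1 := by
  rcases muFn_spec hIk hθ x (t := t) with ⟨⟨h1, -⟩, -⟩ | ⟨-, h⟩
  · exact h1.trans (le_add_right'' _ _)
  · exact h.le

omit hI in
/-- If `muFn ≤ t x̄` then it is a witness. [cite: BussContempMath1990, Thm. 12] -/
theorem θ_muFn (hIk : M ⊨ INDScheme (sigmabFormulas (k + 1))) (hθ : IsSigmabDef (k + 1) θ)
    {x : Fin n → M} (h : muFn θ t x ≤ t x) : θ (Fin.snoc x (muFn θ t x)) := by
  rcases muFn_spec hIk hθ x (t := t) with ⟨⟨-, h2⟩, -⟩ | ⟨-, h2⟩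
  · exact h2
  · rw [h2] at h
    exact ((lt_add_one' _).not_ge h).elim

omit hI in
/-- Below `muFn` there is no witness. [cite: BussContempMath1990, Thm. 12] -/
theorem not_θ_of_lt_muFn (hIk : M ⊨ INDScheme (sigmabFormulas (k + 1)))
    (hθ : IsSigmabDef (k + 1) θ) {x : Fin n → M} {y : M} (hy : y < muFn θ t x) (hyt : y ≤ t x) :
    ¬θ (Fin.snoc x y) := by
  rcases muFn_spec hIk hθ x (t := t) with ⟨-, h3⟩ | ⟨h1, -⟩
  · exact fun h => h3 y hy ⟨hyt, h⟩
  · exact fun h => h1 y ⟨hyt, h⟩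

omit hI in
/-- `muFn` is at most any witness `y ≤ t x̄`. [cite: BussContempMath1990, Thm. 12] -/
theorem muFn_le_of (hIk : M ⊨ INDScheme (sigmabFormulas (k + 1))) (hθ : IsSigmabDef (k + 1) θ)
    {x : Fin n → M} {y : M} (hyt : y ≤ t x) (hy : θ (Fin.snoc x y)) : muFn θ t x ≤ y :=
  not_lt.1 fun h => not_θ_of_lt_muFn hIk hθ h hyt hy

omit hI in
/-- If there is a witness then `muFn ≤ t x̄`. [folklore] -/
theorem muFn_le_t (hIk : M ⊨ INDScheme (sigmabFormulas (k + 1))) (hθ : IsSigmabDef (k + 1) θ)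
    {x : Fin n → M} {y : M} (hyt : y ≤ t x) (hy : θ (Fin.snoc x y)) : muFn θ t x ≤ t x :=
  (muFn_le_of hIk hθ hyt hy).trans hyt

omit hI in
/-- If there is no witness then `muFn = t x̄ + 1`. [folklore] -/
theorem muFn_eq_of_forall_not (hIk : M ⊨ INDScheme (sigmabFormulas (k + 1)))
    (hθ : IsSigmabDef (k + 1) θ) {x : Fin n → M} (h : ∀ y, y ≤ t x → ¬θ (Fin.snoc x y)) :
    muFn θ t x = t x + 1 := by
  rcases muFn_spec hIk hθ x (t := t) with ⟨⟨h1, h2⟩, -⟩ | ⟨-, h2⟩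
  · exact (h _ h1 h2).elim
  · exact h2

/-! ## Arithmetic of halving at a bit position -/

/-- `v / 2^p = 2·(v / 2^{p+1}) + bit p` (`p < |S|`). [folklore] -/
theorem div_pow2B_eq_two_mul_add {S p : M} (hp : p < mLen S) (v : M) :
    v / pow2B S p = 2 * (v / pow2B S (p + 1)) + v / pow2B S p % 2 := by
  rw [pow2B_add_one hp, mul_comm (2 : M) (pow2B S p), ← div_div' v (pow2B S p) 2]
  exact (two_mul_div_two_add_mod_two _).symm

/-- The bit at position `p` is the parity of the shift: `seqEl S 1 v p = v / 2^p mod 2` (`|S| ≥ 1`).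
[folklore] -/
theorem seqEl_one_eq_mod_two {S : M} (hS : 1 ≤ mLen S) (v p : M) :
    seqEl S 1 v p = v / pow2B S p % 2 := by
  rw [seqEl, mul_one, digit, pow2B_one hS]

/-- `2^{d+1} - 1 = 2·(2^d - 1) + 1` (`d < |S|`). [folklore] -/
theorem pow2B_succ_sub_one {S d : M} (hd : d < mLen S) :
    pow2B S (d + 1) - 1 = 2 * (pow2B S d - 1) + 1 := by
  have h1 : 1 ≤ pow2B S d := one_le_pow2B S d
  refine (eq_tsub_of_add_eq (a := 2 * (pow2B S d - 1) + 1) (c := 1) (b := pow2B S (d + 1)) ?_).symm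
  rw [pow2B_add_one hd]
  calc 2 * (pow2B S d - 1) + 1 + 1 = 2 * (pow2B S d - 1 + 1) := by ring
    _ = 2 * pow2B S d := by rw [tsub_add_cancel_of_le h1]

/-- Truncated subtraction across a doubling: `(2a + 1) - (2a' + b) = 2(a - a') + (1 - b)` for
`a' ≤ a`, `b ≤ 1`. [folklore] -/
theorem two_mul_add_one_sub {a a' b : M} (ha : a' ≤ a) (hb : b ≤ 1) :
    (2 * a + 1) - (2 * a' + b) = 2 * (a - a') + (1 - b) := by
  refine (eq_tsub_of_add_eq (a := 2 * (a - a') + (1 - b)) (c := 2 * a' + b) (b := 2 * a + 1) ?_).symm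
  calc 2 * (a - a') + (1 - b) + (2 * a' + b) = 2 * (a - a' + a') + (1 - b + b) := by ring
    _ = 2 * a + 1 := by rw [tsub_add_cancel_of_le ha, tsub_add_cancel_of_le hb]

/-! ## The presentation of `muFn` -/

namespace QPres

section Defs

variable (θ) (t)

/-- The number of bits of a witness: `|t x̄|`. [folklore] -/
def μNB (x : Fin n → M) : M := mLen (t x)

/-- The length bound `2·t x̄ + 1` (of length `|t x̄| + 1`). [folklore] -/
def μS (x : Fin n → M) : M := 2 * t x + 1

/-- The number of queries: `|t x̄| + 1`. [folklore] -/
def μL (x : Fin n → M) : M := μNB t x + 1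

/-- The answer bits above position `p` (below `|t x̄|`), as a number. [folklore] -/
noncomputable def μHi (x : Fin n → M) (w p : M) : M :=
  w % pow2B (μS t x) (μNB t x) / pow2B (μS t x) (p + 1)

/-- The bits of the least witness above position `p`: the complement of `μHi`. [folklore] -/
noncomputable def μPre (x : Fin n → M) (w p : M) : M :=
  (pow2B (μS t x) (μNB t x - 1 - p) - 1) - μHi t x w p

/-- The queries: at the top position `|t x̄|` "is there a witness", at `p < |t x̄|` "is there a
witness with the already determined high bits and bit `p` equal to `0`". [folklore] -/
def μQ (x : Fin n → M) (w p : M) : Prop :=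
  (p = μNB t x ∧ ∃ y, y ≤ t x ∧ θ (Fin.snoc x y)) ∨
    (p < μNB t x ∧ ∃ y, y ≤ t x ∧ (θ (Fin.snoc x y) ∧ y / pow2B (μS t x) p = 2 * μPre t x w p))

/-- The output: the complement of the low `|t x̄|` answer bits if the existence bit is set,
`t x̄ + 1` otherwise. [folklore] -/
noncomputable def μOUT (x : Fin n → M) (w : M) : M :=
  seqEl (μS t x) 1 w (μNB t x) * ((pow2B (μS t x) (μNB t x) - 1) - w % pow2B (μS t x) (μNB t x)) +
    (1 - seqEl (μS t x) 1 w (μNB t x)) * (t x + 1)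

end Defs

section Arith

variable (θ) (t)

omit hI in
/-- `|μS| = |t x̄| + 1`. [folklore] -/
theorem mLen_μS (x : Fin n → M) : mLen (μS t x) = μNB t x + 1 := mLen_two_mul_add_one _

omit hI in
/-- `μNB ≤ |μS|`. [folklore] -/
theorem μNB_le (x : Fin n → M) : μNB t x ≤ mLen (μS t x) := by
  rw [mLen_μS]; exact le_add_right'' _ _

omit hI in
/-- `1 ≤ |μS|`. [folklore] -/
theorem one_le_mLen_μS (x : Fin n → M) : 1 ≤ mLen (μS t x) := by
  rw [mLen_μS]; exact le_add_left'' _ _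

/-- `t x̄ < 2^{|t x̄|}`. [folklore] -/
theorem t_lt_pow2B (x : Fin n → M) : t x < pow2B (μS t x) (μNB t x) :=
  (lt_pow2B_iff (μNB_le t x) _).2 le_rfl

/-- `μHi w p < 2^{|t| - (p+1)}` for `p < |t x̄|`. [folklore] -/
theorem μHi_lt (x : Fin n → M) (w : M) {p : M} (hp : p < μNB t x) :
    μHi t x w p < pow2B (μS t x) (μNB t x - (p + 1)) := by
  have hp1 : p + 1 ≤ μNB t x := (add_one_le_iff' _ _).2 hp
  refine div_pow2B_lt ?_ ?_
  · rw [add_tsub_cancel_of_le hp1]; exact mod_pow2B_lt _ _ _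
  · rw [add_tsub_cancel_of_le hp1]; exact μNB_le t x

/-- Bits of `μHi w p`: bit `q` is bit `q + p + 1` of `w` (when below `|t x̄|`, else `0`).
[folklore] -/
theorem seqEl_μHi (x : Fin n → M) (w : M) {p q : M} (hq : q + (p + 1) < μNB t x) :
    seqEl (μS t x) 1 (μHi t x w p) q = seqEl (μS t x) 1 w (q + (p + 1)) := by
  have h1 : q + (p + 1) + 1 ≤ mLen (μS t x) :=
    ((add_one_le_iff' _ _).2 hq).trans (μNB_le t x)
  rw [μHi, seqEl_one_div_pow2B h1, seqEl_one_mod_pow2B hq (μNB_le t x)]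

/-- **`μHi` depends only on the bits above `p`.** [folklore] -/
theorem μHi_eq_of_bits (x : Fin n → M) {w w' p : M} (hp : p < μNB t x)
    (h : ∀ q, p < q → q + 1 ≤ mLen (μS t x) → seqEl (μS t x) 1 w q = seqEl (μS t x) 1 w' q) :
    μHi t x w p = μHi t x w' p := by
  have hp1 : p + 1 ≤ μNB t x := (add_one_le_iff' _ _).2 hp
  have hL : μNB t x - (p + 1) ≤ mLen (μS t x) := tsub_le_self.trans (μNB_le t x)
  refine ext_of_seqEl_one hL (μHi_lt t x w hp) (μHi_lt t x w' hp) fun q hq => ?_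
  have hq' : q + (p + 1) < μNB t x :=
    calc q + (p + 1) < (μNB t x - (p + 1)) + (p + 1) := by gcongr
      _ = μNB t x := tsub_add_cancel_of_le hp1
  rw [seqEl_μHi t x w hq', seqEl_μHi t x w' hq']
  refine h _ ?_ (((add_one_le_iff' _ _).2 hq').trans (μNB_le t x))
  calc p < p + 1 := lt_add_one' p
    _ ≤ q + (p + 1) := le_add_left'' _ _

/-- **The queries of `muFn` are causal.** [folklore] -/
theorem isCausal_μQ (x : Fin n → M) : IsCausal₁ (μQ θ t x) (μS t x) := by
  intro w w' p hbits
  rcases lt_or_ge p (μNB t x) with hp | hp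
  · have hpre : μPre t x w p = μPre t x w' p := by rw [μPre, μPre, μHi_eq_of_bits t x hp hbits]
    simp only [μQ, hpre]
  · simp only [μQ, not_lt.2 hp, false_and, or_false]

/-! ## Correctness -/

/-- Without a witness the value is `t x̄ + 1`. [folklore] -/
theorem μOUT_of_bit_zero {x : Fin n → M} {w : M} (h : seqEl (μS t x) 1 w (μNB t x) = 0) :
    μOUT t x w = t x + 1 := by
  simp [μOUT, h]

/-- With the existence bit set the value is the complement of the low answer bits. [folklore] -/
theorem μOUT_of_bit_one {x : Fin n → M} {w : M} (h : seqEl (μS t x) 1 w (μNB t x) = 1) :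
    μOUT t x w = (pow2B (μS t x) (μNB t x) - 1) - w % pow2B (μS t x) (μNB t x) := by
  simp [μOUT, h]

end Arith

section Definable

variable (ht : IsTermFn t)
include ht

omit hB hI in
/-- `μNB` is a term function. [folklore] -/
theorem isTermFn_μNB : IsTermFn (μNB t) := ht.len

omit hI in
/-- `μS` is a term function. [folklore] -/
theorem isTermFn_μS : IsTermFn (μS t) := isTermFn_add_one (isTermFn_two_mul ht)

omit hI in
/-- `μL` is a term function. [folklore] -/
theorem isTermFn_μL : IsTermFn (μL t) := isTermFn_add_one (isTermFn_μNB ht)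

/-- `μHi` is a definable function of the query context. [folklore] -/
theorem isSigmabQFn_μHi : IsSigmabQFn k (μHi t) :=
  IsSigmabQFn.divPow2B (IsSigmabQFn.args (isTermFn_μS ht))
    (IsSigmabQFn.of_isTermFn (isTermFn_add_one (IsTermFn.proj (Fin.last (n + 1)))))
    (IsSigmabQFn.modPow2B (IsSigmabQFn.args (isTermFn_μS ht)) (IsSigmabQFn.args (isTermFn_μNB ht))
      IsSigmabQFn.code)

/-- `μPre` is a definable function of the query context. [folklore] -/
theorem isSigmabQFn_μPre : IsSigmabQFn k (μPre t) := by
  have hd : IsSigmabQFn k fun x (_ p : M) => μNB t x - 1 - p :=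
    ((IsSigmabQFn.args (isTermFn_μNB ht)).sub (IsSigmabQFn.args isTermFn_one)).sub IsSigmabQFn.pos
  exact ((IsSigmabQFn.map₂ (isSigmabFn_pow2B' k) (IsSigmabQFn.args (isTermFn_μS ht)) hd).sub
    (IsSigmabQFn.args isTermFn_one)).sub (isSigmabQFn_μHi ht)

omit ht hI in
/-- The existence of a witness, as a `Σᵇₖ₊₁`-definable predicate of `x̄`. [folklore] -/
theorem isSigmabDef_exists_witness (hθ : IsSigmabDef (k + 1) θ) (ht : IsTermFn t) :
    IsSigmabDef (k + 1) fun x : Fin n → M => ∃ y, y ≤ t x ∧ θ (Fin.snoc x y) :=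
  (hθ.bexLE ht).of_iff fun x => by simp [mLe_iff]

/-- **The queries of `muFn` are `Σᵇₖ₊₁`-definable uniformly.** [folklore] -/
theorem isSigmabQuery_μQ (hθ : IsSigmabDef (k + 1) θ) : IsSigmabQuery k (μQ θ t) := by
  have hNB : IsSigmabQFn k fun x (_ _ : M) => μNB t x := IsSigmabQFn.args (isTermFn_μNB ht)
  have h1 : IsSigmabQuery k fun x (_ p : M) => p = μNB t x :=
    IsSigmabQuery.of_isQFDef (isQFDef_eq (IsTermFn.proj _) (isTermFn_init_init (isTermFn_μNB ht)))
  have h2 : IsSigmabQuery k fun x (_ _ : M) => ∃ y, y ≤ t x ∧ θ (Fin.snoc x y) :=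
    (IsSigmabDef.comp (isSigmabDef_exists_witness hθ ht) fun j : Fin n => j.castSucc.castSucc).of_iff
      fun _ => Iff.rfl
  have h3 : IsSigmabQuery k fun x (_ p : M) => p < μNB t x := IsSigmabQuery.lt IsSigmabQFn.pos hNB
  -- the matrix on the context `(x̄, w, p, y)` : `Fin (n + 3)`
  let e : Fin (n + 1) → Fin (n + 3) :=
    Fin.snoc (α := fun _ => Fin (n + 3)) (fun i : Fin n => i.castSucc.castSucc.castSucc) (Fin.last (n + 2))
  have hθ' : IsSigmabDef (k + 1) fun u : Fin (n + 3) → M =>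
      θ (Fin.snoc (Fin.init (Fin.init (Fin.init u))) (u (Fin.last (n + 2)))) := by
    refine (IsSigmabDef.comp hθ e).of_iff fun u => ?_
    have : u ∘ e = Fin.snoc (Fin.init (Fin.init (Fin.init u))) (u (Fin.last (n + 2))) := by
      funext i
      cases i using Fin.lastCases with
      | last => simp [e]
      | cast i => simp [e, Fin.init]
    rw [this]
  have hdiv : IsSigmabFn (k + 1) fun u : Fin (n + 3) → M =>
      u (Fin.last (n + 2)) / pow2B (μS t (Fin.init (Fin.init (Fin.init u)))) (u (Fin.last (n + 1)).castSucc) :=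
    (isSigmabFn_of_isTermFn (IsTermFn.proj (Fin.last (n + 2))) _).div₂
      ((isSigmabFn_of_isTermFn (isTermFn_init3 (isTermFn_μS ht)) _).pow2B₂
        (isSigmabFn_of_isTermFn (IsTermFn.proj (Fin.last (n + 1)).castSucc) _))
  have hpre : IsSigmabFn (k + 1) fun u : Fin (n + 3) → M =>
      2 * μPre t (Fin.init (Fin.init (Fin.init u))) (u (Fin.last n).castSucc.castSucc)
        (u (Fin.last (n + 1)).castSucc) :=
    (isSigmabFn_of_isTermFn isTermFn_two _).mul₂
      ((IsSigmabFn.comp (isSigmabQFn_μPre ht (k := k)) Fin.castSucc).of_eq fun _ => rfl)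
  have hmat : IsSigmabDef (k + 1) fun u : Fin (n + 3) → M =>
      θ (Fin.snoc (Fin.init (Fin.init (Fin.init u))) (u (Fin.last (n + 2)))) ∧
        u (Fin.last (n + 2)) / pow2B (μS t (Fin.init (Fin.init (Fin.init u)))) (u (Fin.last (n + 1)).castSucc) =
          2 * μPre t (Fin.init (Fin.init (Fin.init u))) (u (Fin.last n).castSucc.castSucc)
            (u (Fin.last (n + 1)).castSucc) :=
    hθ'.and (hdiv.isDeltabDef_eq hpre).1
  have h4 : IsSigmabQuery k fun x w p => ∃ y, y ≤ t x ∧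
      (θ (Fin.snoc x y) ∧ y / pow2B (μS t x) p = 2 * μPre t x w p) := by
    refine (hmat.bexLE (isTermFn_init_init ht)).of_iff fun u => ?_
    simp [mLe_iff, Fin.init_snoc, Fin.snoc_castSucc, Fin.snoc_last]
  exact (h1.and h2).or (h3.and h4)

/-- **The output of `muFn` is `Σᵇₖ₊₁`-definable uniformly** (it is `Σᵇ₁` arithmetic of the code).
[folklore] -/
theorem isSigmabOut_μOUT : IsSigmabOut k (μOUT t) := by
  have hS : IsSigmabOut k fun x (_ : M) => μS t x := IsSigmabOut.args (isTermFn_μS ht)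
  have hNB : IsSigmabOut k fun x (_ : M) => μNB t x := IsSigmabOut.args (isTermFn_μNB ht)
  have he : IsSigmabOut k fun x w => seqEl (μS t x) 1 w (μNB t x) :=
    ((isSigmabFn_seqEl.mono (Nat.le_add_left 1 k)).substAll (isTermFn_vec4
      (isTermFn_init (isTermFn_μS ht)) isTermFn_one (IsTermFn.proj (Fin.last n))
      (isTermFn_init (isTermFn_μNB ht)))).of_eq fun _ => rfl
  have hsub : IsSigmabFn (k + 1) fun w : Fin 2 → M => w 0 - w 1 :=
    isSigmabFn_sub (IsTermFn.proj 0) (IsTermFn.proj 1) _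
  have hP : IsSigmabOut k fun x (_ : M) => pow2B (μS t x) (μNB t x) :=
    IsSigmabOut.map₂ (isSigmabFn_pow2B' k) hS hNB
  have hA : IsSigmabOut k fun x w => (pow2B (μS t x) (μNB t x) - 1) - w % pow2B (μS t x) (μNB t x) :=
    IsSigmabOut.map₂ hsub (IsSigmabOut.map₂ hsub hP (IsSigmabOut.args isTermFn_one))
      (IsSigmabOut.modPow2B hS hNB IsSigmabOut.code)
  have hT : IsSigmabOut k fun x (_ : M) => t x + 1 := IsSigmabOut.args (isTermFn_add_one ht)
  exact IsSigmabOut.map₂ (isSigmabFn_add _) (IsSigmabOut.map₂ (isSigmabFn_mul _) he hA)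
    (IsSigmabOut.map₂ (isSigmabFn_mul _) (IsSigmabOut.map₂ hsub (IsSigmabOut.args isTermFn_one) he) hT)

/-- **The presentation of `muFn θ t`** (Buss 1990, Thm. 12: bounded least-witness search, here
by `|t| + 1` adaptive queries). [cite: BussContempMath1990, Thm. 12] -/
noncomputable def mu (hθ : IsSigmabDef (k + 1) θ) : QPres M k n where
  L := μL t
  S := μS t
  Q := μQ θ t
  OUT := μOUT t
  isTermFn_L := isTermFn_μL ht
  isTermFn_S := isTermFn_μS ht
  L_le := fun x => by rw [mLen_μS]; exact le_rfl
  one_le := one_le_mLen_μS t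
  isSigmabQuery := isSigmabQuery_μQ ht hθ
  isCausal := isCausal_μQ θ t
  isSigmabOut := isSigmabOut_μOUT ht

omit ht in
/-- **The answer bits are the complemented bits of the least witness**: for `d ≤ |t x̄|`, the top
`d` bits of the answer block equal the complement of the top `d` bits of the least witness `y*`
(open induction on `d`; the answer code `W` and `y*` are parameters). [cite: BussContempMath1990, Thm. 12] -/
theorem μ_top_bits {x : Fin n → M} {W : M} (hW : IsAnswerCode (μQ θ t x) (μS t x) (μL t x) W)
    {ys : M} (hys : ys ≤ t x ∧ θ (Fin.snoc x ys)) (hleast : ∀ y', y' < ys → ¬(y' ≤ t x ∧ θ (Fin.snoc x y'))) :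
    ∀ d, d ≤ μNB t x →
      W % pow2B (μS t x) (μNB t x) / pow2B (μS t x) (μNB t x - d) =
        (pow2B (μS t x) d - 1) - ys / pow2B (μS t x) (μNB t x - d) := by
  set S := μS t x with hSdef
  set NB := μNB t x with hNBdef
  set V := W % pow2B S NB with hV
  have hS1 : 1 ≤ mLen S := one_le_mLen_μS t x
  have hNBS : NB ≤ mLen S := μNB_le t x
  have hmS : mLen S = NB + 1 := mLen_μS t x
  have hyNB : ys < pow2B S NB := lt_of_le_of_lt hys.1 (t_lt_pow2B t x)
  intro d
  refine ind (P := fun d => d ≤ NB → V / pow2B S (NB - d) = (pow2B S d - 1) - ys / pow2B S (NB - d))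
    ?_ ?_ ?_ d
  · -- definability (an open implication of a `Δᵇ₁` equation)
    have hd : IsSigmabFn 1 fun v : Fin 1 → M => pow2B S (NB - v 0) :=
      (isSigmabFn_of_isTermFn (IsTermFn.const S) 1).pow2B₂
        ((isSigmabFn_of_isTermFn (IsTermFn.const NB) 1).sub₂ (isSigmabFn_of_isTermFn (IsTermFn.proj 0) 1))
    have hL : IsSigmabFn 1 fun v : Fin 1 → M => V / pow2B S (NB - v 0) :=
      (isSigmabFn_of_isTermFn (IsTermFn.const V) 1).div₂ hd
    have hR : IsSigmabFn 1 fun v : Fin 1 → M => (pow2B S (v 0) - 1) - ys / pow2B S (NB - v 0) :=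
      (((isSigmabFn_of_isTermFn (IsTermFn.const S) 1).pow2B₂ (isSigmabFn_of_isTermFn (IsTermFn.proj 0) 1)).sub₂
        (isSigmabFn_of_isTermFn isTermFn_one 1)).sub₂ ((isSigmabFn_of_isTermFn (IsTermFn.const ys) 1).div₂ hd)
    exact IsSigmabDef.imp ((isQFDef_le (IsTermFn.proj 0) (IsTermFn.const NB)).isPibDef 1)
      (hL.isDeltabDef_eq hR).1
  · intro _
    rw [tsub_zero, pow2B_zero, tsub_self, zero_tsub, (div_eq_zero_iff' (pow2B_pos S NB)).2 (mod_pow2B_lt _ _ _)]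
  · intro d ih hd1
    have hdNB : d < NB := (add_one_le_iff' _ _).1 hd1
    have hdS : d < mLen S := lt_of_lt_of_le hdNB hNBS
    -- the position just determined: `p = NB - (d + 1)`, so that `NB - d = p + 1`
    set p := NB - (d + 1) with hpdef
    have hNBp : NB = p + (d + 1) := (tsub_add_cancel_of_le hd1).symm
    have hpNB : p < NB := by
      rw [hNBp]
      calc p < p + 1 := lt_add_one' p
        _ ≤ p + 1 + d := le_add_right'' _ _
        _ = p + (d + 1) := by ring
    have hpS : p < mLen S := lt_of_lt_of_le hpNB hNBS
    have hNBd : NB - d = p + 1 := by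
      rw [hNBp]
      have : p + (d + 1) = (p + 1) + d := by ring
      rw [this, add_tsub_cancel_right]
    have hd' : NB - 1 - p = d := by
      rw [hNBp]
      have : p + (d + 1) = (d + p) + 1 := by ring
      rw [this, add_tsub_cancel_right, add_tsub_cancel_right]
    have ih' := ih hdNB.le
    rw [hNBd] at ih'
    -- halving identities
    have eV : V / pow2B S p = 2 * (V / pow2B S (p + 1)) + seqEl S 1 W p := by
      rw [div_pow2B_eq_two_mul_add hpS, ← seqEl_one_eq_mod_two hS1, hV,
        seqEl_one_mod_pow2B hpNB hNBS]
    have ey : ys / pow2B S p = 2 * (ys / pow2B S (p + 1)) + ys / pow2B S p % 2 :=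
      div_pow2B_eq_two_mul_add hpS ys
    have hb1 : ys / pow2B S p % 2 ≤ 1 := mod_two_le_one _
    -- `ys / 2^{p+1} ≤ 2^d - 1`
    have hpd : p + 1 + d = NB := by rw [hNBp]; ring
    have hylt : ys / pow2B S (p + 1) < pow2B S d := by
      refine div_pow2B_lt ?_ ?_
      · rw [hpd]; exact hyNB
      · rw [hpd]; exact hNBS
    have hyle : ys / pow2B S (p + 1) ≤ pow2B S d - 1 :=
      le_tsub_of_add_le_right ((add_one_le_iff' _ _).2 hylt)
    -- the prefix asked about at `p` is the true high part of `ys`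
    have hpre : μPre t x W p = ys / pow2B S (p + 1) := by
      rw [μPre, ← hNBdef, ← hSdef, hd', μHi, ← hSdef, ← hNBdef, ← hV, ih', tsub_tsub_cancel_of_le hyle]
    -- the answer bit at `p`
    have hpL : p < μL t x := lt_of_lt_of_le hpNB (le_add_right'' _ _)
    have hbit : seqEl S 1 W p = 1 ↔ ys / pow2B S p % 2 = 0 := by
      rw [hW.bit_iff hpL]
      constructor
      · rintro (⟨hpeq, -⟩ | ⟨-, y, hyt, hθy, hyeq⟩)
        · exact (hpNB.ne hpeq).elim
        · rw [hpre] at hyeq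
          by_contra hb
          have hb1' : ys / pow2B S p % 2 = 1 :=
            le_antisymm hb1 ((one_le_iff_ne_zero' _).2 hb)
          have hlt : y / pow2B S p < ys / pow2B S p := by
            rw [hyeq, ey, hb1']
            exact lt_add_one' _
          have hyy : y < ys := by
            by_contra hge
            exact hlt.not_ge (div_le_div_right_model (not_lt.1 hge) _)
          exact hleast y hyy ⟨hyt, hθy⟩
      · intro hb0
        refine Or.inr ⟨hpNB, ys, hys.1, hys.2, ?_⟩
        rw [hpre, ey, hb0, add_zero]
    -- conclude
    rw [eV, ey, ih', pow2B_succ_sub_one hdS, two_mul_add_one_sub hyle hb1]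
    congr 1
    rcases seqEl_one_eq_zero_or_eq_one hS1 W p with h0 | h1
    · rw [h0]
      have : ys / pow2B S p % 2 ≠ 0 := fun hb => by rw [hbit.2 hb] at h0; exact one_ne_zero h0
      rw [le_antisymm hb1 ((one_le_iff_ne_zero' _).2 this), tsub_self]
    · rw [h1, hbit.1 h1, tsub_zero]

/-- **Value of the presentation of `muFn`** (Buss 1990, Thm. 12). [cite: BussContempMath1990, Thm. 12] -/
theorem eval_mu (hIk : M ⊨ INDScheme (sigmabFormulas (k + 1))) (hθ : IsSigmabDef (k + 1) θ)
    (x : Fin n → M) : (mu ht hθ).eval x = muFn θ t x := by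
  have hW : IsAnswerCode (μQ θ t x) (μS t x) (μL t x) ((mu ht hθ).code x) :=
    (mu ht hθ).isAnswerCode_code hIk x
  set W := (mu ht hθ).code x with hWdef
  have hS1 : 1 ≤ mLen (μS t x) := one_le_mLen_μS t x
  have hNBL : μNB t x < μL t x := lt_add_one' _
  change μOUT t x W = muFn θ t x
  by_cases hex : ∃ y, y ≤ t x ∧ θ (Fin.snoc x y)
  · -- the least witness
    obtain ⟨y, hyt, hθy⟩ := hex
    set ys := muFn θ t x with hys
    have hysT : ys ≤ t x := muFn_le_t hIk hθ hyt hθy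
    have hysθ : θ (Fin.snoc x ys) := θ_muFn hIk hθ hysT
    have hleast : ∀ y', y' < ys → ¬(y' ≤ t x ∧ θ (Fin.snoc x y')) := fun y' hy' h =>
      not_θ_of_lt_muFn hIk hθ hy' h.1 h.2
    have hbit : seqEl (μS t x) 1 W (μNB t x) = 1 :=
      hW.bit_eq_one hNBL (Or.inl ⟨rfl, y, hyt, hθy⟩)
    rw [μOUT_of_bit_one t hbit]
    have htop := μ_top_bits hW ⟨hysT, hysθ⟩ hleast (μNB t x) le_rfl
    rw [tsub_self, pow2B_zero, div_one', div_one'] at htop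
    rw [htop]
    refine tsub_tsub_cancel_of_le (le_tsub_of_add_le_right ((add_one_le_iff' _ _).2 ?_))
    exact lt_of_le_of_lt hysT (t_lt_pow2B t x)
  · push Not at hex
    have hbit : seqEl (μS t x) 1 W (μNB t x) = 0 := by
      refine hW.bit_eq_zero hS1 hNBL ?_
      rintro (⟨-, y, hyt, hθy⟩ | ⟨hlt, -⟩)
      · exact hex y hyt hθy
      · exact lt_irrefl _ hlt
    rw [μOUT_of_bit_zero t hbit, muFn_eq_of_forall_not hIk hθ hex]

end Definable

end QPres

/-- **Bounded least-witness search** (Buss 1990, Thm. 12, semantically): for a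
`Σᵇₖ₊₁`-definable `θ(x̄, y)` and a term function `t`, the function `muFn θ t = (μ y ≤ t) θ` is
query-presentable at level `k + 1` (in a model of `BASIC + Σᵇ₁-IND + Σᵇₖ₊₁-IND`).
[cite: BussContempMath1990, Thm. 12] -/
theorem IsQFn.muFn (hIk : M ⊨ INDScheme (sigmabFormulas (k + 1))) {θ : (Fin (n + 1) → M) → Prop}
    (hθ : IsSigmabDef (k + 1) θ) {t : (Fin n → M) → M} (ht : IsTermFn t) : IsQFn k (muFn θ t) :=
  ⟨QPres.mu ht hθ, fun x => (QPres.eval_mu ht hIk hθ x).symm⟩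

end Mu

end BASICModel

end Literature.Computability.MetaComplexity
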